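import Literature.NumberTheory.Sieve.RoughOmegaCellsClassesBVPrimesAux
import Literature.NumberTheory.Sieve.PolymathGEHPrimePieceLevel
import Literature.NumberTheory.Sieve.ParityBarrierLevelProofs
import Literature.NumberTheory.Sieve.DivisorBound
import HarnessLib

/-!
# Bombieri–Vinogradov for the `Ω`-cells of the rough integers, III: the prime variable

Topic `Literature/NumberTheory/Sieve`, sub-namespace `RoughCellsAP`.  Everything here is PROVED.
Two inputs about the primes for the averaged equidistribution of the `Ω`-cells of the rough integers
(Motohashi 1976; Bombieri–Friedlander–Iwaniec 1986, Theorem 0 (b)):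

* `siegelWalfiszHyp_primePiece` — the indicator `β = 1_{primes in (m, m']}` of a box of primes inside
  a dyadic range `(N, 2N]`, `N ≥ X^{1/(2n)}`, satisfies hypothesis (A₂) of BFI in the vendored form
  `BFI.SiegelWalfiszHyp N 1 Csw β` with constants `Csw` depending on `n` only.  Small moduli
  `k ≤ (log 2N)^{4A}` come from the Siegel–Walfisz theorem through Polymath's Claim 2.6 for prime
  pieces (`primePiece_siegelWalfisz_uniform`), large moduli from the trivial bound
  (`disc_le_large_moduli`), and sparse boxes (`‖β‖² ≤ N (log 2N)^{−2A}`) as well as small `N` from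
  `|Δ| ≤ 2 Σ β = 2‖β‖²` (tools in `RoughOmegaCellsClassesBVPrimesAux.lean`).
* `sum_abs_primesClassDisc_le` — the cell `Ω = 1` (the primes of `[N₀, T]`): level `X^{1/4}` with
  an arbitrary logarithmic saving, read off the Bombieri–Vinogradov theorem in `π`-form
  (`sum_iSup_apDiscrepancy_primePiece_le`, `BombieriVinogradovStatement_holds`).

## References

* Y. Motohashi, Proc. Japan Acad. 52 (1976), 273–275.
* E. Bombieri, J. B. Friedlander, H. Iwaniec, Acta Math. 156 (1986), 203–251, §1 (A₂) p. 206 and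
  §2 Theorem 0 p. 211. [BombieriFriedlanderIwaniecActa1986]
* H. Iwaniec, E. Kowalski, *Analytic Number Theory*, AMS Coll. Publ. 53 (2004), Thm 17.1.
  [IwaniecKowalski2004]
-/

open Finset Real Filter
open scoped ArithmeticFunction.sigma

namespace Literature.NumberTheory.Sieve

namespace RoughCellsAP

open BFI

/-! ### Hypothesis (A₂) for boxes of primes -/

set_option maxHeartbeats 400000 in
/-- **Boxes of primes satisfy BFI's hypothesis (A₂)**: for `n ≥ 1` there is a family of constants
`Csw` such that for all `X ≥ 1`, all `X^{1/(2n)} ≤ N ≤ X` and all `m, m'` with `N < m + 1`,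
`m' ≤ 2N`, the prime piece `1_{primes in (m, m']}` satisfies `BFI.SiegelWalfiszHyp N 1 Csw`.
[cite: BombieriFriedlanderIwaniecActa1986, §1 (A₂) p. 206] -/
theorem siegelWalfiszHyp_primePiece {n : ℕ} (hn : 0 < n) :
    ∃ Csw : ℝ → ℝ, ∀ X : ℝ, 1 ≤ X → ∀ N : ℝ, X ^ (1 / (2 * (n : ℝ))) ≤ N → N ≤ X →
      ∀ m m' : ℕ, N < (m : ℝ) + 1 → (m' : ℝ) ≤ 2 * N →
        SiegelWalfiszHyp N 1 Csw ⇑(primePiece m m') := by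
  suffices h : ∀ A : ℝ, ∃ C : ℝ, 0 < A → ∀ X : ℝ, 1 ≤ X → ∀ N : ℝ, X ^ (1 / (2 * (n : ℝ))) ≤ N → N ≤ X →
      ∀ m m' : ℕ, N < (m : ℝ) + 1 → (m' : ℝ) ≤ 2 * N →
      ∀ d k : ℕ, 1 ≤ d → 1 ≤ k → ∀ l : ℤ, IsCoprime (k : ℤ) l →
        |(∑ v ∈ dyadic N, if (v : ZMod k) = (l : ZMod k) ∧ v.Coprime d then primePiece m m' v else 0) -
            (∑ v ∈ dyadic N, if v.Coprime (d * k) then primePiece m m' v else 0) / (Nat.totient k : ℝ)| ≤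
          C * Real.sqrt (l2Sq N ⇑(primePiece m m')) * N ^ (1 / 2 : ℝ) * (σ 0 d : ℝ) ^ (1 : ℝ) /
            Real.log (2 * N) ^ A by
    choose C hC using h
    exact ⟨C, fun X hX N hN1 hN2 m m' hm hm' A hA d k hd hk l hl =>
      hC A hA X hX N hN1 hN2 m m' hm hm' d k hd hk l hl⟩
  intro A
  by_cases hA : 0 < A
  swap
  · exact ⟨0, fun h => absurd h hA⟩
  -- constants
  have hn0 : (0 : ℝ) < n := by exact_mod_cast hn
  have hc₀ : (0 : ℝ) < 1 / (4 * (n : ℝ)) := by positivity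
  obtain ⟨CP, hCP⟩ := primePiece_siegelWalfisz_uniform hc₀ 4 (by norm_num) 1 le_rfl (6 * A) (by positivity)
  obtain ⟨xP, hxP⟩ := Filter.eventually_atTop.1 hCP
  obtain ⟨Cτ, hCτ1, hCτ⟩ := exists_sigma_zero_le_mul_rpow (ε := 1 / 2) (by norm_num)
  obtain ⟨N₁, hN₁1, hN₁⟩ := exists_threshold_log A
  set X₁ : ℝ := max xP ((4 : ℝ) ^ (4 * n)) with hX₁
  have hX₁1 : 1 ≤ X₁ := le_trans (one_le_pow₀ (by norm_num)) (le_max_right _ _)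
  set L₁ : ℝ := Real.log (2 * N₁) ^ A + Real.log (2 * X₁) ^ A with hL₁
  have hL₁0 : 0 ≤ L₁ := by
    have h1 : 0 ≤ Real.log (2 * N₁) := Real.log_nonneg (by linarith)
    have h2 : 0 ≤ Real.log (2 * X₁) := Real.log_nonneg (by linarith)
    positivity
  have hCP0 : (0 : ℝ) ≤ max CP 0 := le_max_right _ _
  set Cbig : ℝ := 4 * L₁ + 2 * max CP 0 + 3 * Cτ + 5 with hCbig
  refine ⟨Cbig, fun _ X hX N hNX hNX' m m' hm hm' d k hd hk l hl => ?_⟩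
  -- basic facts
  have hN1 : 1 ≤ N := le_trans (Real.one_le_rpow hX (by positivity)) hNX
  have hN0 : 0 < N := by linarith
  have hlog0 : 0 < Real.log (2 * N) := Real.log_pos (by linarith)
  set L : ℝ := Real.log (2 * N) with hLdef
  set β : ℕ → ℝ := ⇑(primePiece m m') with hβdef
  set Z : ℝ := l2Sq N β with hZdef
  have hZsum : Z = ∑ v ∈ dyadic N, β v := l2Sq_primePiece_eq N m m'
  have hβ01 : ∀ v, β v = 0 ∨ β v = 1 := primePiece_eq_zero_or_one m m'
  have hβabs : ∀ v, |β v| = β v := fun v => by rcases hβ01 v with h | h <;> simp [h]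
  have hZ0 : 0 ≤ Z := l2Sq_nonneg N β
  have hZ3 : Z ≤ 3 * N := by
    rw [hZsum]
    calc ∑ v ∈ dyadic N, β v ≤ ∑ v ∈ dyadic N, (1 : ℝ) :=
          Finset.sum_le_sum fun v _ => by rcases hβ01 v with h | h <;> simp [h]
      _ = #(dyadic N) := by simp
      _ ≤ 2 * N + 1 := card_dyadic_le hN0.le
      _ ≤ 3 * N := by linarith
  have hτ1 : (1 : ℝ) ≤ (σ 0 d : ℝ) ^ (1 : ℝ) := by
    rw [Real.rpow_one]; exact_mod_cast one_le_sigma_zero (by omega : d ≠ 0)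
  haveI : NeZero k := ⟨by omega⟩
  have hlu : IsUnit ((l : ℤ) : ZMod k) := (ZMod.unitOfIsCoprime l hl.symm).isUnit
  -- the discrepancy and its trivial bound `D ≤ 2Z ≤ 4 √Z √N`
  rw [← Finset.sum_filter, ← Finset.sum_filter]
  set D : ℝ := |(∑ v ∈ (dyadic N).filter (fun v : ℕ => (v : ZMod k) = ((l : ℤ) : ZMod k) ∧ v.Coprime d), β v) -
      (∑ v ∈ (dyadic N).filter (fun v : ℕ => v.Coprime (d * k)), β v) / (Nat.totient k : ℝ)| with hD
  have htriv : D ≤ 2 * Z := by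
    refine (abs_disc_le_two_sum_abs β hk _ d).trans (le_of_eq ?_)
    rw [hZsum, Finset.sum_congr rfl fun v _ => hβabs v]
  have htriv' : D ≤ 4 * Real.sqrt Z * N ^ (1 / 2 : ℝ) := htriv.trans (two_mul_le_sqrt_mul hZ0 hZ3)
  have hLA : 0 < L ^ A := Real.rpow_pos_of_pos hlog0 A
  have hsqN : 0 ≤ Real.sqrt Z * N ^ (1 / 2 : ℝ) := by positivity
  -- reduction: it suffices to bound `D L^A ≤ K √Z √N` with `0 ≤ K ≤ Cbig`
  rw [le_div_iff₀ hLA]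
  have hCbig0 : 0 ≤ Cbig := by rw [hCbig]; linarith [hL₁0, hCP0, hCτ1]
  have hgoalτ : ∀ K : ℝ, K ≤ Cbig →
      D * L ^ A ≤ K * (σ 0 d : ℝ) ^ (1 : ℝ) * (Real.sqrt Z * N ^ (1 / 2 : ℝ)) →
      D * L ^ A ≤ Cbig * Real.sqrt (l2Sq N β) * N ^ (1 / 2 : ℝ) * (σ 0 d : ℝ) ^ (1 : ℝ) := by
    intro K hK h
    calc D * L ^ A ≤ K * (σ 0 d : ℝ) ^ (1 : ℝ) * (Real.sqrt Z * N ^ (1 / 2 : ℝ)) := h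
      _ ≤ Cbig * (σ 0 d : ℝ) ^ (1 : ℝ) * (Real.sqrt Z * N ^ (1 / 2 : ℝ)) :=
          mul_le_mul_of_nonneg_right (mul_le_mul_of_nonneg_right hK (by positivity)) hsqN
      _ = _ := by rw [hZdef]; ring
  have hgoal : ∀ K : ℝ, 0 ≤ K → K ≤ Cbig → D * L ^ A ≤ K * (Real.sqrt Z * N ^ (1 / 2 : ℝ)) →
      D * L ^ A ≤ Cbig * Real.sqrt (l2Sq N β) * N ^ (1 / 2 : ℝ) * (σ 0 d : ℝ) ^ (1 : ℝ) := by
    intro K hK0 hK h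
    refine hgoalτ K hK (h.trans ?_)
    calc K * (Real.sqrt Z * N ^ (1 / 2 : ℝ)) = K * 1 * (Real.sqrt Z * N ^ (1 / 2 : ℝ)) := by rw [mul_one]
      _ ≤ K * (σ 0 d : ℝ) ^ (1 : ℝ) * (Real.sqrt Z * N ^ (1 / 2 : ℝ)) :=
          mul_le_mul_of_nonneg_right (mul_le_mul_of_nonneg_left hτ1 hK0) hsqN
  by_cases hsmall : X < X₁ ∨ N < N₁
  · -- small `X` or small `N`: `L^A ≤ L₁`
    have hLL₁ : L ^ A ≤ L₁ := by
      rcases hsmall with h | h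
      · have h1 : L ≤ Real.log (2 * X₁) := Real.log_le_log (by linarith) (by linarith)
        have h2 : L ^ A ≤ Real.log (2 * X₁) ^ A := Real.rpow_le_rpow hlog0.le h1 hA.le
        have h3 : 0 ≤ Real.log (2 * N₁) ^ A := Real.rpow_nonneg (Real.log_nonneg (by linarith)) _
        linarith
      · have h1 : L ≤ Real.log (2 * N₁) := Real.log_le_log (by linarith) (by linarith)
        have h2 : L ^ A ≤ Real.log (2 * N₁) ^ A := Real.rpow_le_rpow hlog0.le h1 hA.le
        have h3 : 0 ≤ Real.log (2 * X₁) ^ A := Real.rpow_nonneg (Real.log_nonneg (by linarith)) _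
        linarith
    refine hgoal (4 * L₁) (by positivity) (by rw [hCbig]; linarith [hCP0, hCτ1]) ?_
    calc D * L ^ A ≤ (4 * Real.sqrt Z * N ^ (1 / 2 : ℝ)) * L₁ :=
          mul_le_mul htriv' hLL₁ hLA.le (by positivity)
      _ = 4 * L₁ * (Real.sqrt Z * N ^ (1 / 2 : ℝ)) := by ring
  push Not at hsmall
  obtain ⟨hXX₁, hNN₁⟩ := hsmall
  obtain ⟨hL1, hL2A⟩ := hN₁ N hNN₁
  have hL2A0 : 0 < L ^ (2 * A) := Real.rpow_pos_of_pos hlog0 _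
  by_cases hsparse : Z ≤ N / L ^ (2 * A)
  · -- sparse box: `D ≤ 2Z ≤ 2 √Z √N / L^A`
    refine hgoal 2 (by norm_num) (by rw [hCbig]; linarith [hL₁0, hCP0, hCτ1]) ?_
    have h1 : Real.sqrt Z ≤ N ^ (1 / 2 : ℝ) / L ^ A := by
      rw [← Real.sqrt_eq_rpow, Real.sqrt_le_left (by positivity), div_pow, ← rpow_two_mul_eq_sq hlog0.le,
        Real.sq_sqrt hN0.le]
      exact hsparse
    calc D * L ^ A ≤ 2 * Z * L ^ A := mul_le_mul_of_nonneg_right htriv hLA.le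
      _ = 2 * (Real.sqrt Z * Real.sqrt Z) * L ^ A := by rw [Real.mul_self_sqrt hZ0]
      _ ≤ 2 * (Real.sqrt Z * (N ^ (1 / 2 : ℝ) / L ^ A)) * L ^ A := by gcongr
      _ = 2 * (Real.sqrt Z * N ^ (1 / 2 : ℝ)) := by field_simp
  -- dense box: an absolute bound `D ≤ K N / L^{2A}` suffices
  push Not at hsparse
  have hdens : N / L ^ (2 * A) ≤ Real.sqrt Z * N ^ (1 / 2 : ℝ) / L ^ A :=
    div_rpow_le_sqrt_mul hN0.le hlog0 hsparse
  have habsτ : ∀ K : ℝ, K ≤ Cbig → D ≤ K * (σ 0 d : ℝ) ^ (1 : ℝ) * (N / L ^ (2 * A)) →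
      D * L ^ A ≤ Cbig * Real.sqrt (l2Sq N β) * N ^ (1 / 2 : ℝ) * (σ 0 d : ℝ) ^ (1 : ℝ) := by
    intro K hK h
    refine hgoalτ K hK ?_
    have hK0 : 0 ≤ K * (σ 0 d : ℝ) ^ (1 : ℝ) := by
      by_contra hneg
      push Not at hneg
      have h1 : D < 0 := lt_of_le_of_lt h (by
        have : 0 < N / L ^ (2 * A) := by positivity
        nlinarith)
      linarith [abs_nonneg ((∑ v ∈ (dyadic N).filter (fun v : ℕ => (v : ZMod k) = ((l : ℤ) : ZMod k) ∧
        v.Coprime d), β v) - (∑ v ∈ (dyadic N).filter (fun v : ℕ => v.Coprime (d * k)), β v) /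
          (Nat.totient k : ℝ))]
    calc D * L ^ A ≤ K * (σ 0 d : ℝ) ^ (1 : ℝ) * (N / L ^ (2 * A)) * L ^ A := mul_le_mul_of_nonneg_right h hLA.le
      _ ≤ K * (σ 0 d : ℝ) ^ (1 : ℝ) * (Real.sqrt Z * N ^ (1 / 2 : ℝ) / L ^ A) * L ^ A := by gcongr
      _ = K * (σ 0 d : ℝ) ^ (1 : ℝ) * (Real.sqrt Z * N ^ (1 / 2 : ℝ)) := by field_simp
  have habs : ∀ K : ℝ, 0 ≤ K → K ≤ Cbig → D ≤ K * (N / L ^ (2 * A)) →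
      D * L ^ A ≤ Cbig * Real.sqrt (l2Sq N β) * N ^ (1 / 2 : ℝ) * (σ 0 d : ℝ) ^ (1 : ℝ) := by
    intro K hK0 hK h
    refine habsτ K hK (h.trans ?_)
    calc K * (N / L ^ (2 * A)) = K * 1 * (N / L ^ (2 * A)) := by rw [mul_one]
      _ ≤ K * (σ 0 d : ℝ) ^ (1 : ℝ) * (N / L ^ (2 * A)) :=
          mul_le_mul_of_nonneg_right (mul_le_mul_of_nonneg_left hτ1 hK0) (by positivity)
  by_cases hksmall : (k : ℝ) ≤ L ^ (4 * A)
  · -- small moduli: Polymath's Claim 2.6 for prime pieces (Siegel–Walfisz)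
    have hZpos : 0 < Z := lt_of_le_of_lt (by positivity) hsparse
    obtain ⟨v₀, hv₀, hv₀ne⟩ : ∃ v ∈ dyadic N, β v ≠ 0 := by
      by_contra hcon
      push Not at hcon
      rw [hZsum, Finset.sum_eq_zero hcon] at hZpos
      exact lt_irrefl _ hZpos
    have hmm' : m < m' := by
      have := primePiece_ne_zero_iff.1 hv₀ne
      omega
    -- hypotheses of `primePiece_siegelWalfisz_uniform` at `x = 2X`
    obtain ⟨hmx, hm4⟩ := rpow_two_mul_le_of_scale hn (le_trans (le_max_right _ _) hXX₁) (lt_of_le_of_lt hNX hm)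
    have hm'4 : (m' : ℝ) ≤ 4 * m := by linarith
    have hm'x : (m' : ℝ) ≤ 2 * X := by linarith
    have hxP2 : xP ≤ 2 * X := by
      have : xP ≤ X₁ := le_max_left _ _
      linarith
    have hP := hxP (2 * X) hxP2 m m' hmx hmm'.le hm'4 hm'x k d hk hd (ZMod.unitOfIsCoprime l hl.symm)
    have hfloor : ⌊(4 : ℝ) * m⌋₊ = 4 * m := by
      rw [show (4 : ℝ) * m = ((4 * m : ℕ) : ℝ) by push_cast; ring, Nat.floor_natCast]
    rw [hfloor, apDiscrepancy_primePiece_eq hN0.le hm hm' d k, ZMod.coe_unitOfIsCoprime, pow_one] at hP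
    -- bookkeeping
    have hm2N : (m : ℝ) ≤ 2 * N := by
      have : (m : ℝ) < m' := by exact_mod_cast hmm'
      linarith
    have hτkd : (σ 0 (k * d) : ℝ) ≤ (σ 0 k : ℝ) * (σ 0 d : ℝ) := by exact_mod_cast sigma_zero_mul_le k d
    have hτk : (σ 0 k : ℝ) ≤ L ^ (4 * A) := by
      have h2 : (σ 0 k : ℝ) ≤ k := by
        rw [ArithmeticFunction.sigma_zero_apply]; exact_mod_cast Nat.card_divisors_le_self k
      exact h2.trans hksmall
    have hK := small_moduli_bookkeeping hA hlog0 (Real.log_le_log (by linarith) (by linarith)) hP hτkd hτk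
      (Nat.cast_nonneg _) (Nat.cast_nonneg _) hm2N (Nat.cast_nonneg _)
    refine habsτ (2 * max CP 0) (by rw [hCbig]; linarith [hL₁0, hCτ1]) ?_
    rw [Real.rpow_one]
    exact hK
  · -- large moduli: the trivial bound
    push Not at hksmall
    refine habs (3 * Cτ + 3) (by linarith [hCτ1]) (by rw [hCbig]; linarith [hL₁0, hCP0]) ?_
    exact disc_le_large_moduli hβ01 hN1 hL1 hL2A hA hCτ1 hCτ hk hksmall hlu d

/-! ### The cell `Ω = 1`: primes in progressions at level `X^{1/4}` -/

/-- **The primes of `[N₀, T]` at level `X^{1/4}`** (Bombieri–Vinogradov in `π`-form): for every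
`A > 0` there are `C, x₀` such that for all `X ≥ x₀`, all `2 ≤ N₀ ≤ T + 1` with `T ≤ X` and all
reduced residues `c_q`,
`Σ_{q ≤ X^{1/4}} |#{N₀ ≤ p ≤ T : p ≡ c_q (q)} − #{N₀ ≤ p ≤ T : p ∤ q}/φ(q)| ≤ C X/(log X)^A`.
[cite: IwaniecKowalski2004, Theorem 17.1] -/
theorem sum_abs_primesClassDisc_le {A : ℝ} (hA : 0 < A) :
    ∃ C x₀ : ℝ, ∀ X : ℝ, x₀ ≤ X → ∀ N₀ T : ℕ, 2 ≤ N₀ → N₀ ≤ T + 1 → (T : ℝ) ≤ X →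
      ∀ c : ℕ → ℕ, (∀ q : ℕ, 0 < q → (c q).Coprime q) →
        ∑ q ∈ Finset.Icc 1 ⌊X ^ ((1 : ℝ) / 4)⌋₊,
          |(#(((Finset.Icc N₀ T).filter Nat.Prime).filter (fun b : ℕ => b ≡ c q [MOD q])) : ℝ) -
            (#(((Finset.Icc N₀ T).filter Nat.Prime).filter (fun b : ℕ => b.Coprime q)) : ℝ) /
              (Nat.totient q : ℝ)| ≤ C * X / Real.log X ^ A := by
  have hpi : PrimesHaveLevelPi (3 / 8) := BombieriVinogradovStatement_holds.primesHaveLevelPi (by norm_num)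
  obtain ⟨C, hC⟩ := sum_iSup_apDiscrepancy_primePiece_le (θ := 1 / 4) (θ' := 3 / 8) (by norm_num) (by norm_num)
    hpi hA
  obtain ⟨x₀, hx₀⟩ := Filter.eventually_atTop.1 hC
  refine ⟨C, x₀, fun X hX N₀ T hN₀ hNT hTX c hc => ?_⟩
  have h := hx₀ X hX (N₀ - 1) T T (by omega) (by omega) hTX le_rfl
  refine le_trans (Finset.sum_le_sum fun q hq => ?_) h
  have hq1 : 1 ≤ q := (Finset.mem_Icc.1 hq).1
  haveI : NeZero q := ⟨by omega⟩
  set a : (ZMod q)ˣ := ZMod.unitOfCoprime (c q) (hc q hq1) with ha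
  refine le_trans (le_of_eq ?_) (le_ciSup (Finite.bddAbove_range _) a)
  -- identify the two discrepancies
  have hset : ∀ (P : ℕ → Prop) [DecidablePred P],
      (#(((Finset.Icc N₀ T).filter Nat.Prime).filter P) : ℝ) =
        ∑ n ∈ (Finset.Icc 1 T).filter P, (primePiece (N₀ - 1) T n : ℝ) := by
    intro P _
    simp only [primePiece_apply]
    rw [Finset.sum_boole]
    congr 1
    refine congrArg Finset.card ?_
    ext n
    simp only [Finset.mem_filter, Finset.mem_Icc]
    constructor
    · rintro ⟨⟨⟨h1, h2⟩, hp⟩, hP⟩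
      exact ⟨⟨⟨by omega, h2⟩, hP⟩, by omega, h2, hp⟩
    · rintro ⟨⟨⟨-, h2⟩, hP⟩, h3, -, hp⟩
      exact ⟨⟨⟨by omega, h2⟩, hp⟩, hP⟩
  simp only [apDiscrepancy]
  rw [hset, hset, ha, ZMod.coe_unitOfCoprime]
  congr 3
  refine Finset.filter_congr fun n _ => ?_
  exact (ZMod.natCast_eq_natCast_iff _ _ _).symm

end RoughCellsAP

end Literature.NumberTheory.Sieve
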